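import Summits.AtomisticToContinuum.FouriersLaw.Theorems.VanishingNoiseTransferNoisyFourierFlipFiniteResponseAux2
import Summits.AtomisticToContinuum.FouriersLaw.Theorems.VanishingNoiseTransferNoisyFourierFlipFiniteResponseAux3
import Summits.AtomisticToContinuum.FouriersLaw.Theorems.VanishingNoiseTransferNoisyFourierFlipPositiveConductanceAux3
import Summits.AtomisticToContinuum.FouriersLaw.Theorems.VanishingNoiseTransferVanishingNoiseBoundFlipHypoelliptic
import Summits.AtomisticToContinuum.FouriersLaw.Theorems.VanishingNoiseTransferVanishingNoiseBoundFlipSmoothMildUpgrade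
import Summits.AtomisticToContinuum.FouriersLaw.Theorems.VanishingNoiseTransferVanishingNoiseBoundFlipMildContinuity
import Literature.MathematicalPhysics.KineticTheory.VelocityFlipNoise
import HarnessLib

/-!
# Stub `stub_flipFiniteResponse` of line `sector-dirichlet-gluing`
(crux `VanishingNoiseTransfer.NoisyFourier`, item stmt-AtomisticToContinuum-11977)

Fixed-`N` linear response of the pinned anharmonic chain `pinnedChain ω₂ lam β γ` (`ω₂, lam, β, γ > 0`) with
velocity flips at rate `ε > 0`: GIVEN uniqueness of weak flip steady states (`OscillatorChain.IsFlipSteadyState`),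
along every flip-steady family `μ N T_L T_R` and for every `T > 0` and every `N`, the response limit
`D_N(ε) = lim_{δ→0, δ≠0} totalCurrent(μ_{N,T+δ/2,T−δ/2})/δ` EXISTS.

Proof = ROAD B, the dual Kubo road built for the sister crux `VanishingNoiseBound` (stmt-AtomisticToContinuum-11976)
and this line, composed end to end:
* the dual forward field hypothesis `H_road` of that road follows from its four fixed-`N` inputs by the landed
  assembly `NoisyFourier.FlipPositiveConductance.dualForwardFields_of_mild_hypo_upgrade_cont`
  (…NoisyFourierFlipPositiveConductanceAux3), all four being theorems of the tree:
  MILD `NoisyFourier.FlipFiniteResponse.helper_flipFiniteResponseMildDistributional` (mild forward fields are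
  distributional, …NoisyFourierFlipFiniteResponseAux3), HYPO `VanishingNoiseBound.stub_flipHypoelliptic`
  (flip-hypoellipticity, …VanishingNoiseBoundFlipHypoelliptic), UPGRADE `VanishingNoiseBound.stub_flipSmoothMildUpgrade`
  (…VanishingNoiseBoundFlipSmoothMildUpgrade), CONT `VanishingNoiseBound.stub_flipMildContinuity` (continuity of the
  Gibbs pairings of the mild family at zero bias, …VanishingNoiseBoundFlipMildContinuity);
* `H_road` implies the stub: `NoisyFourier.FlipFiniteResponse.flipFiniteResponse_of_dualKuboRoad`
  (…NoisyFourierFlipFiniteResponseAux2: the exact dual response identity `flip_dualKubo_identity` turns the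
  centring constants `∫ (p_0² − T) dμ_δ` into `(γδ/2T²)(A_δ − B_δ)`, the pairings converge, and
  `totalCurrent(μ_δ) = (N−1)γ(T + δ/2 − ∫ p_0² dμ_δ)`; `D = 0` for `N ≤ 1`,
  `D = (N−1)γ(1/2 − (γ/(2T²))(A_0 − B_0))` for `N ≥ 2`).
-/

namespace Summit.AtomisticToContinuum.FouriersLaw.Cruxes.NoisyFourier.SectorDirichletGluing

open Literature.MathematicalPhysics.KineticTheory.HeatConduction

/-- **Stub 2 of line `sector-dirichlet-gluing` — the fixed-`N` linear response of the flip chain exists** (under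
uniqueness of flip steady states, along every flip-steady family, every `T > 0`, every `N`). ROAD B: the dual
Kubo road of crux `VanishingNoiseBound` (MILD, HYPO, UPGRADE, CONT, assembly) and the `flip_dualKubo_identity`
adapter. [Bonetto–Lebowitz–Rey-Bellet 2000, §5.2–5.3, eq. (27), (32); Rey-Bellet 2003, Rem. 4.4;
Bernardin–Olla 2011, §2.1] [folklore] -/
theorem stub_flipFiniteResponse :
    ∀ ω₂ lam β γ : ℝ, 0 < ω₂ → 0 < lam → 0 < β → 0 < γ → ∀ ε : ℝ, 0 < ε →
      (∀ (N : ℕ) (T_L T_R : ℝ), 0 < T_L → 0 < T_R →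
        ∀ μ ν : MeasureTheory.Measure
            (Literature.MathematicalPhysics.KineticTheory.HeatConduction.PhaseSpace N),
          (Literature.MathematicalPhysics.KineticTheory.HeatConduction.pinnedChain
              ω₂ lam β γ).IsFlipSteadyState N T_L T_R ε μ →
          (Literature.MathematicalPhysics.KineticTheory.HeatConduction.pinnedChain
              ω₂ lam β γ).IsFlipSteadyState N T_L T_R ε ν → μ = ν) →
      ∀ μ : (N : ℕ) → ℝ → ℝ → MeasureTheory.Measure
          (Literature.MathematicalPhysics.KineticTheory.HeatConduction.PhaseSpace N),
        (∀ (N : ℕ) (T_L T_R : ℝ), 0 < T_L → 0 < T_R →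
          (Literature.MathematicalPhysics.KineticTheory.HeatConduction.pinnedChain
              ω₂ lam β γ).IsFlipSteadyState N T_L T_R ε (μ N T_L T_R)) →
        ∀ T : ℝ, 0 < T → ∀ N : ℕ, ∃ D : ℝ,
          Filter.Tendsto (fun δ : ℝ =>
            (Literature.MathematicalPhysics.KineticTheory.HeatConduction.pinnedChain
                ω₂ lam β γ).totalCurrent (μ N (T + δ / 2) (T - δ / 2)) / δ)
            (nhdsWithin 0 {(0 : ℝ)}ᶜ) (nhds D) :=
  Summit.AtomisticToContinuum.FouriersLaw.Theorems.NoisyFourier.FlipFiniteResponse.flipFiniteResponse_of_dualKuboRoad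
    (Summit.AtomisticToContinuum.FouriersLaw.Theorems.NoisyFourier.FlipPositiveConductance.dualForwardFields_of_mild_hypo_upgrade_cont
      Summit.AtomisticToContinuum.FouriersLaw.Theorems.NoisyFourier.FlipFiniteResponse.helper_flipFiniteResponseMildDistributional
      Summit.AtomisticToContinuum.FouriersLaw.Theorems.VanishingNoiseBound.stub_flipHypoelliptic
      Summit.AtomisticToContinuum.FouriersLaw.Theorems.VanishingNoiseBound.stub_flipSmoothMildUpgrade
      Summit.AtomisticToContinuum.FouriersLaw.Theorems.VanishingNoiseBound.stub_flipMildContinuity)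

end Summit.AtomisticToContinuum.FouriersLaw.Cruxes.NoisyFourier.SectorDirichletGluing
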